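import Summits.QuantumFields.BalabanUV.T4Continuum.Spine.NE1p.DressedRebornMuPart
import Summits.QuantumFields.BalabanUV.T4Continuum.Spine.NE1p.DressedSmallFieldCoresMassWitness

/-!
# T⁴ programme, spine estimate NE1′ (node O3b/H2) — WITNESS «THE DRESSED REGENERATION CONSTANT IS CHARGED»: S56's bilinear END
# `rebornMuPart_locE_le_of_coresAt_bipencil_mass` APPLIED ONCE BY NAME on W35's letter-budget core read along the BI-PENCIL
# `0 + μ • liveTable + s • (¼ • liveTable)` (source direction = W33's live table, content = a quarter of it; source radius `½`, room
# `3∕2`), and the bounded MIXED DIFFERENCE `E(¼,1) − E(0,1) − E(¼,0) + E(0,0)` is NOT ZERO — by Cauchy–Schwarz against the Gaussian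
# weight and the exact second difference `∫ (e^{ρ∕4} − 1)² e^{−v²} dv > 0` of the toy's activity

Cell `pub-balaban`, sub-cell `t4`, BINDER-OWNERS row NE1′; NE1′ formalisation crew, unit `b2b-balaban-t4-ne1p-formalise-leaf-03`
(LEAF PROVER 03, generation 14); crew row W86 ∕ DAG N29zzzzt of `t4/formal/NE1p/LEAVES.md` (INTENT + STAGED journal l.23705, BOOKED typer R-T142 l.23746 under the
RENAME hold — this module name `DressedRebornMuPartBipencilWitness` is the typer's suggestion; the sibling `DressedRebornMuPartWitness`
is leaf-06's W84 = S56 §2's exp-linear applier, and leaf-09's W87 fires the `_window` form on a separable two-domain datum — three rows,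
S56's three ENDs' first appliers, no «first» claimed here; own-lineage follower of S56 `DressedRebornMuPart` (p239964) and W68
`DressedRegenerationWitness` (p239345) — W51∕W68's pattern for the BILINEAR face at the cores).  ADDITIVE — imports S56 `Spine/NE1p/DressedRebornMuPart`
and W35 `Spine/NE1p/DressedSmallFieldCoresMassWitness` (p227752-lineage; → W33 `DressedSmallFieldCoresWitness` → W24 `DressedSmallFieldTorusWitness`)
ONLY; THEOREMS ONLY (0 def, 0 `def … : Prop`, 0 cite); every toy datum is W33∕W35∕W24's BY NAME (`coreFam`, `cM`, `actM`, `ctr0`, `hroom0`,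
`termsW`, `X₀`, `liveTable`, `Acst`, `hrate_torus`, `hsmall_mu`, `hM3_mu`, `incr`, `crd`, `gaussian_E1`, `exp_locE_cube`, `actM_real_sub_zero`,
`norm_actM_X₀_lt_one`, `termBi_coreFam_M`, `readOut_coreW_smul_liveTable`); nothing restated.

WHY THIS FILE.  S56 typed the DRESSED regeneration constant — the re-born μ-part of a family's regenerated output is BILINEAR in (source, content),
`‖E(μ,1) − E(0,1) − (E(μ,0) − E(0,0))‖ ≤ 2·(2M∕μ₁·‖μ‖)∕ε·‖v‖` — at the cores with (B1a) discharged; like S52 before W68 it had no DECIDED applier, and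
unlike the one-variable faces its bounded quantity is a SECOND-ORDER difference, which vanishes for every output AFFINE along the pencil: liveness is
not inherited from W35∕W51∕W68's first-order liveness.  Here:
* §1 toy plumbing (kernel, W33∕W35 BY NAME): `liveTable_ne_zero` (W33's read-out `readOut p v (s • liveTable) = s·r·e^{−v₀²}` is not constant in
  `s` when `0 < r`), the class radii `hH_bi` (`‖0 − 0‖ + ½‖liveTable‖ + 3∕2 ≤ 2`), the letter budget `hM3_bi` (W35 `hM3_mu`, growth read at `2`,
  by monotonicity), and the bi-pencil's activity `hact_bi`: `actM (μ + s·¼)` IS the (2.14)-sum along `0 + μ • liveTable + s • (¼ • liveTable)`.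
* §2 `rebornEnd_fires` (kernel; S56 §3 EXACTLY ONCE BY NAME at `μ₁ := ½`, `ε := 3∕2`, `u := liveTable`, `v := ¼ • liveTable`, NE5's toy letters
  `(1, 0, 1)` INLINE as in W51∕W68): for `‖μ‖ < ½` the mixed difference of `E(μ,s) := E[actM (μ + s·¼)](X₀)` over `{0, μ} × {0, 1}` is
  `≤ 2·(2M∕½·‖μ‖)∕(3∕2)·‖¼ • liveTable‖`; `rebornEnd_fires_closed`: `≤ (16∕3)·K₀(64,8)·‖μ‖·‖¼ • liveTable‖`.
* §3 GENUINE — `reborn_live`: at `μ = ¼` the mixed difference `E[actM ½](X₀) − E[actM ¼](X₀) − (E[actM ¼](X₀) − E[actM 0](X₀)) ≠ 0`.  Proof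
  (kernel, [folklore] real analysis on W33's integrands): were it zero, W24's `exp_locE_cube` would give `(1 + a(½))(1 + a(0)) = (1 + a(¼))²` for the
  activities `a(t) = actM t (X₀) = c·(√π + ∫ incr(t·r))` (W35 `actM_real_sub_zero`, `c = cM r > 0`); but with `G = √π = ∫ e^{−v²}`,
  `I₁ = ∫ incr(r∕4)`, `I₂ = ∫ incr(r∕2)` and `J = I₂ − 2I₁ = ∫ (e^{ρ∕4} − 1)² e^{−v²} > 0` (`ρ = r·e^{−v₀²}`), the difference of the two sides is
  `c·J + c²·(G·J − I₁²)`, and `I₁² ≤ G·J` is CAUCHY–SCHWARZ for `∫ (e^{ρ∕4} − 1)·e^{−v²}` against the Gaussian weight (`sq_integral_le` — the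
  `0 ≤ ∫ (φ − λ)²·g` trick at `λ = I₁∕G`, no `Lp` machinery); `rebornEnd_live`: the quantity bounded in §2 at `μ = ¼` is non-zero AND
  `≤ (4∕3)·K₀(64,8)·‖¼ • liveTable‖`.

HONEST FRAMING.  A decided toy on pv22's periodic carrier; W33∕W35∕W24's objects BY NAME; [folklore] kernel steps only (Cauchy–Schwarz by completing
the square, positivity of the integral of a continuous positive function); `16∕3·K₀·‖μ‖·‖v‖` is a READING of the dressed (w5) constant along the
bi-pencil — (B1a) exercised at a TOY core, (w5) NOT discharged on Bałaban's densities; nothing of Bałaban's (2.14) data ∕ densities ∕ minimisers ∕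
backgrounds instantiated (0 binders instantiated on Bałaban's densities); (B1b)∕(B3)∕(B5) untouched ((B3) = G-ne9p2-5 UNPRINTED, shared with NE9);
no wall item; the NE1′ wall wording of record v1.8 (T4-DAG v48) — words, not kind — does NOT move; R-t4r2-Q2 NOT met; ABSOLUTE RULE honoured (no
numeral of print; nothing internally minted is cited).  NE1′ ⇐ the named binders — NOT proved, NOT printed; spine PROVED 0∕9; count 9 unchanged.
Rung (B)+1 on ONE finite four-torus — NOT infinite volume, NOT a mass gap, NOT OS on ℝ⁴, NOT Clay.  HONEST DEPENDENCY: continuum YM on T⁴ ⇐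
BetaPertH ∧ nine spine estimates (0/9 proved); BetaPertH ⇐ (D1) ∧ (D4) ∧ CAP+tail; G-an2-4 gates asym, D1 and NE2/3/4.
-/

noncomputable section

namespace Summit.QuantumFields.BalabanUV.T4Continuum.NE1p.DressedRebornMuPartBipencilWitness

open Set Metric MeasureTheory Complex
open scoped BigOperators
open Literature.MathematicalPhysics.QuantumFieldTheory.Balaban1983to89
open Literature.MathematicalPhysics.QuantumFieldTheory.Balaban1983to89.B12TreeDecay (K₀ K₀_pos)
open Literature.MathematicalPhysics.QuantumFieldTheory.Balaban1983to89.B13Resummation (locE)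
open Literature.MathematicalPhysics.QuantumFieldTheory.Balaban1983to89.TreeLengthTorus (TDom tsys)
open Literature.MathematicalPhysics.QuantumFieldTheory.Balaban1983to89.TreeLengthTorusGeometry (tgeometry TTouch)
open Summit.QuantumFields.BalabanUV.T4Continuum.B13HistMeasurable (B13HistM)
open Summit.QuantumFields.BalabanUV.T4Continuum.B13HistWitness (toyFrame)
open Summit.QuantumFields.BalabanUV.T4Continuum.B13TermParamGaussianBi (BiCore termBi)
open Summit.QuantumFields.BalabanUV.T4Continuum.NE1p.DressedSmallFieldTorusWitness (X₀ X₀_val hrate_torus exp_locE_cube)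
open Summit.QuantumFields.BalabanUV.T4Continuum.NE1p.DressedSmallFieldGeometry (torus_consts)
open Summit.QuantumFields.BalabanUV.T4Continuum.NE1p.DressedSmallFieldGeometryFaces (K₀_four)
open Summit.QuantumFields.BalabanUV.T4Continuum.NE1p.DressedSmallFieldCoresWitness (E1 crd liveTable norm_liveTable_le coreW coreFam
  readOut_coreW_smul_liveTable ctr0 hroom0 gaussian_E1 Acst Acst_pos termsW termsW_X₀ incr integrable_incr integrable_gauss_E1)
open Summit.QuantumFields.BalabanUV.T4Continuum.NE1p.DressedSmallFieldCoresMassWitness (cM cM_pos actM hM3_mu hsmall_mu termBi_coreFam_M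
  actM_real_sub_zero norm_actM_X₀_lt_one)
open Summit.QuantumFields.BalabanUV.T4Continuum.NE1p.DressedRebornMuPart (rebornMuPart_locE_le_of_coresAt_bipencil_mass)

variable (N : ℕ) [NeZero N] (r : ℝ) (hr : 0 ≤ r)

/-! ## §1 Toy plumbing for the bi-pencil `0 + μ • liveTable + s • (¼ • liveTable)` -/

/-- **THE LIVE TABLE IS NOT ZERO** for `0 < r` [decided toy]: W33's read-out along it, `readOut p v (s • liveTable) = s·r·e^{−v₀²}`, takes
different values at `s = 0` and `s = 1`. [folklore] -/
theorem liveTable_ne_zero (hr0 : 0 < r) : (liveTable : B13HistM toyFrame) ≠ 0 := by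
  intro h
  have h1 := readOut_coreW_smul_liveTable (c := cM r) r hr0.le () (0 : E1) 1
  rw [h, smul_zero, map_zero, one_mul, ← Complex.ofReal_mul] at h1
  have h2 : r * Real.exp (-(crd (0 : E1) ^ 2)) = 0 := Complex.ofReal_eq_zero.1 h1.symm
  exact (mul_pos hr0 (Real.exp_pos _)).ne' h2

/-- The content `¼ • liveTable` has POSITIVE size. [folklore] -/
theorem norm_quarter_liveTable_pos (hr0 : 0 < r) : 0 < ‖((1 / 4 : ℂ)) • (liveTable : B13HistM toyFrame)‖ := by
  rw [norm_smul]
  exact mul_pos (by norm_num) (norm_pos_iff.2 (liveTable_ne_zero r hr0))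

/-- … and size `≤ ¼ < 3∕2` (the room). [folklore] -/
theorem norm_quarter_liveTable_lt : ‖((1 / 4 : ℂ)) • (liveTable : B13HistM toyFrame)‖ < 3 / 2 := by
  rw [norm_smul]
  have h : ‖(1 / 4 : ℂ)‖ = 1 / 4 := by norm_num
  rw [h]
  linarith [norm_liveTable_le, norm_nonneg (liveTable : B13HistM toyFrame)]

/-- The class radii for the bi-pencil: source radius `½` along `liveTable`, room `3∕2` for the content, inside W33's table ball of radius
`2`. [folklore] -/
theorem hH_bi (k : ℕ) :
    ‖(0 : B13HistM toyFrame) - (ctr0 k (fun _ => 0) ()).2‖ + (1 / 2) * ‖(liveTable : B13HistM toyFrame)‖ + 3 / 2 ≤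
      (fun _ : ℕ => (2 : ℝ)) k := by
  show ‖(0 : B13HistM toyFrame) - 0‖ + (1 / 2) * ‖(liveTable : B13HistM toyFrame)‖ + 3 / 2 ≤ 2
  rw [sub_zero, norm_zero, zero_add]
  linarith [norm_liveTable_le, norm_nonneg (liveTable : B13HistM toyFrame)]

/-- **(B3) FOR THE BI-PENCIL** [decided toy]: S56's letter budget reads the read-out growth at the table radius `‖0‖ + ½‖liveTable‖ + 3∕2`
(≤ 2); it follows from W35's `hM3_mu` (growth read at `2`, EQUALITY at `X₀`) by monotonicity of `exp`. [folklore] -/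
theorem hM3_bi (k : ℕ) (R : ℝ) :
    ∀ Z : (tsys 4 N).Dom, (tgeometry 4 N).cubes Z ⊆ (tgeometry 4 N).cubes (X₀ N) →
      ∑ i ∈ termsW N Z, (coreFam (cM r) r hr k i k).lam.real univ *
          ((coreFam (cM r) r hr k i k).wB * (fun (_ : ℕ) (_ : Unit) (_ : ℕ) => (1 : ℝ)) k i k *
            Real.exp ((fun (_ : ℕ) (_ : Unit) (_ : ℕ) => (0 : ℝ)) k i k)) *
          (Real.pi / ((fun (_ : ℕ) (_ : Unit) (_ : ℕ) => (1 : ℝ)) k i k / 2)) ^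
            (Module.finrank ℝ E1 / 2 : ℝ) *
        Real.exp ((coreFam (cM r) r hr k i k).N₁ *
          (‖(0 : B13HistM toyFrame)‖ + (1 / 2) * ‖(liveTable : B13HistM toyFrame)‖ + 3 / 2)) ≤
      Acst * Real.exp (-(R * (tsys 4 N).dj Z)) := by
  intro Z hZ
  refine le_trans (Finset.sum_le_sum fun i _ => ?_) (hM3_mu N r hr k R Z hZ)
  have hx : ‖(0 : B13HistM toyFrame)‖ + (1 / 2) * ‖(liveTable : B13HistM toyFrame)‖ + 3 / 2 ≤ 2 := by
    rw [norm_zero, zero_add]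
    linarith [norm_liveTable_le, norm_nonneg (liveTable : B13HistM toyFrame)]
  refine mul_le_mul_of_nonneg_left (Real.exp_le_exp.2 (mul_le_mul_of_nonneg_left hx (coreFam (cM r) r hr k i k).N₁_nonneg)) ?_
  refine mul_nonneg (mul_nonneg measureReal_nonneg (mul_nonneg (mul_nonneg ?_ zero_le_one) (Real.exp_pos _).le))
    (Real.rpow_nonneg (div_nonneg Real.pi_pos.le (by norm_num)) _)
  exact (norm_nonneg _).trans ((coreFam (cM r) r hr k i k).norm_w_le ())

/-- The bi-pencil IS W35's source pencil read at `μ + s·¼`: `0 + μ • liveTable + s • (¼ • liveTable) = 0 + (μ + s·¼) • liveTable`. [folklore] -/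
theorem bipencil_eq (z : ℂ × ℂ) :
    (0 : B13HistM toyFrame) + z.1 • liveTable + z.2 • ((1 / 4 : ℂ) • liveTable) = 0 + (z.1 + z.2 * (1 / 4 : ℂ)) • liveTable := by
  rw [smul_smul, add_smul, add_assoc]

/-- **THE ACTIVITY ALONG THE BI-PENCIL** [decided toy]: `actM (μ + s·¼)` is the (2.14)-sum of W33's cores at the table
`0 + μ • liveTable + s • (¼ • liveTable)` — S56 §3's `hact` for `act z := actM (z.1 + z.2·¼)`. [folklore] -/
theorem hact_bi (k : ℕ) :
    ∀ z ∈ ball (0 : ℂ) (1 / 2) ×ˢ ball (0 : ℂ) ((3 / 2) / ‖((1 / 4 : ℂ)) • (liveTable : B13HistM toyFrame)‖), ∀ Z : (tsys 4 N).Dom,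
      actM N r hr k (z.1 + z.2 * (1 / 4 : ℂ)) Z =
        ∑ i ∈ termsW N Z, (coreFam (cM r) r hr k i k).termAt 0 ((0 : B13HistM toyFrame) + z.1 • liveTable + z.2 • ((1 / 4 : ℂ) • liveTable)) := by
  intro z _ Z
  rw [bipencil_eq]
  rfl

/-! ## §2 S56's BILINEAR END FIRES on the bi-pencil -/

open Classical in
/-- **S56 §3 `rebornMuPart_locE_le_of_coresAt_bipencil_mass` FIRES ON THE LIVE CORE** [decided toy]: W33's core family at W35's weight `cM`,
NE5's toy letters `(mq, bq, N₀) = (1, 0, 1)` INLINE in the literal binder shapes, W33's `hroom0`∕`ctr0`, `hH_bi`, `hM3_bi`, `hact_bi`, W24's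
`hrate_torus`, W35's `hsmall_mu`; source radius `μ₁ = ½`, room `ε = 3∕2`, content `v = ¼ • liveTable` (`0 < ‖v‖ < 3∕2`).  Conclusion LITERAL for
`‖μ‖ < ½`: the mixed difference of `E(μ,s) = E[actM (μ + s·¼)](X₀)` over `{0, μ} × {0, 1}` is `≤ 2·(2·M∕½·‖μ‖)∕(3∕2)·‖¼ • liveTable‖`,
`M = e·ν·c₁·K₀²·A·e⁰`. [folklore] -/
theorem rebornEnd_fires (hr0 : 0 < r) (k : ℕ) {μ : ℂ} (hμ : μ ∈ ball (0 : ℂ) (1 / 2)) :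
    ‖locE (tgeometry 4 N).ι (tgeometry 4 N).cubes (actM N r hr k (μ + 1 * (1 / 4 : ℂ))) ((tgeometry 4 N).cubes (X₀ N)) -
        locE (tgeometry 4 N).ι (tgeometry 4 N).cubes (actM N r hr k (0 + 1 * (1 / 4 : ℂ))) ((tgeometry 4 N).cubes (X₀ N)) -
        (locE (tgeometry 4 N).ι (tgeometry 4 N).cubes (actM N r hr k (μ + 0 * (1 / 4 : ℂ))) ((tgeometry 4 N).cubes (X₀ N)) -
          locE (tgeometry 4 N).ι (tgeometry 4 N).cubes (actM N r hr k (0 + 0 * (1 / 4 : ℂ))) ((tgeometry 4 N).cubes (X₀ N)))‖ ≤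
      2 * (2 * (Real.exp 1 * (tgeometry 4 N).ν * (tgeometry 4 N).c₁ * (tgeometry 4 N).K₀ ^ 2 * Acst *
        Real.exp (-(0 * (tsys 4 N).dj (X₀ N)))) / (1 / 2) * ‖μ‖) / (3 / 2) * ‖((1 / 4 : ℂ)) • (liveTable : B13HistM toyFrame)‖ :=
  rebornMuPart_locE_le_of_coresAt_bipencil_mass (tsys 4 N) (tgeometry 4 N) (coreFam (cM r) r hr)
    (W := Set.univ) (ctr := ctr0) (ROp := fun _ => 1) (RHist := fun _ => 2) (R' := fun _ => 2)
    (mq := fun _ _ _ => 1) (bq := fun _ _ _ => 0) (N₀ := fun _ _ _ => 1)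
    hroom0 (fun _ _ _ _ _ _ _ => one_pos)
    (fun _ _ _ _ _ _ _ => ⟨fun _ _ => aestronglyMeasurable_const, fun _ => differentiableOn_const _, fun _ _ _ => by
      show ‖(1 : ℂ)‖ ≤ 1; rw [norm_one]⟩)
    (fun _ _ _ _ _ _ _ => ⟨fun _ _ => (Complex.measurable_ofReal.comp (measurable_snd.norm.pow_const 2)).aestronglyMeasurable,
      fun _ _ => differentiableOn_const _, fun _ _ _ v => by
        show 1 * ‖v‖ ^ 2 - 0 ≤ (((‖v‖ ^ 2 : ℝ) : ℂ)).re; rw [Complex.ofReal_re]; simp⟩)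
    (g := fun _ => 0) (Set.mem_univ _) (U := ()) (o := 0) (h₀ := 0) (u := liveTable) (v := (1 / 4 : ℂ) • liveTable) (μ₁ := 1 / 2)
    (ε := 3 / 2) (norm_quarter_liveTable_pos r hr0) (norm_quarter_liveTable_lt)
    (by show ‖(0 : ℂ) - 0‖ ≤ 1; simp) (hH_bi k)
    (emb := fun _ => k) (fun _ => rfl) (terms := termsW N) (act := fun z => actM N r hr k (z.1 + z.2 * (1 / 4 : ℂ))) (hact_bi N r hr k)
    (A := Acst) (R := 2 * (tgeometry 4 N).κ₀ + 2) (r₁ := 0) (b₅ := 0) (X₀ := X₀ N)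
    Acst_pos.le le_rfl (by norm_num) (hrate_torus N) (hsmall_mu N) (hM3_bi N r hr k _) hμ

open Classical in
/-- … in CLOSED FORM: `≤ (16∕3)·K₀(64,8)·‖μ‖·‖¼ • liveTable‖` (pv22's constants BY NAME; `e·ν·c₁·K₀²·A = K₀(64,8)`). [folklore] -/
theorem rebornEnd_fires_closed (hr0 : 0 < r) (k : ℕ) {μ : ℂ} (hμ : μ ∈ ball (0 : ℂ) (1 / 2)) :
    ‖locE (tgeometry 4 N).ι (tgeometry 4 N).cubes (actM N r hr k (μ + 1 * (1 / 4 : ℂ))) ((tgeometry 4 N).cubes (X₀ N)) -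
        locE (tgeometry 4 N).ι (tgeometry 4 N).cubes (actM N r hr k (0 + 1 * (1 / 4 : ℂ))) ((tgeometry 4 N).cubes (X₀ N)) -
        (locE (tgeometry 4 N).ι (tgeometry 4 N).cubes (actM N r hr k (μ + 0 * (1 / 4 : ℂ))) ((tgeometry 4 N).cubes (X₀ N)) -
          locE (tgeometry 4 N).ι (tgeometry 4 N).cubes (actM N r hr k (0 + 0 * (1 / 4 : ℂ))) ((tgeometry 4 N).cubes (X₀ N)))‖ ≤
      16 / 3 * K₀ 64 8 * ‖μ‖ * ‖((1 / 4 : ℂ)) • (liveTable : B13HistM toyFrame)‖ := by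
  refine (rebornEnd_fires N r hr hr0 k hμ).trans (le_of_eq ?_)
  rw [(torus_consts N).1, (torus_consts N).2.2, K₀_four, zero_mul, neg_zero, Real.exp_zero, mul_one]
  unfold Acst
  have hK := K₀_pos (64 : ℝ) 8
  have he := Real.exp_pos 1
  field_simp
  ring

/-! ## §3 GENUINE: the mixed difference is NOT ZERO — Cauchy–Schwarz against the Gaussian weight -/

/-- [folklore] **CAUCHY–SCHWARZ BY COMPLETING THE SQUARE**: for a weight `g ≥ 0` with `0 < ∫ g` and a function `φ`, if `φ·g`, `φ²·g` and
`g` are integrable then `(∫ φ·g)² ≤ (∫ φ²·g)·(∫ g)` — from `0 ≤ ∫ (φ − λ)²·g` at `λ = (∫ φ·g)∕(∫ g)`; no `Lp` space enters. -/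
theorem sq_integral_le {α : Type*} [MeasurableSpace α] {ν : Measure α} {φ g : α → ℝ} (hg0 : ∀ x, 0 ≤ g x)
    (hφg : Integrable (fun x => φ x * g x) ν) (hφ2g : Integrable (fun x => φ x ^ 2 * g x) ν) (hg : Integrable g ν)
    (hG : 0 < ∫ x, g x ∂ν) :
    (∫ x, φ x * g x ∂ν) ^ 2 ≤ (∫ x, φ x ^ 2 * g x ∂ν) * ∫ x, g x ∂ν := by
  set I := ∫ x, φ x * g x ∂ν with hI
  set G := ∫ x, g x ∂ν with hGdef
  set c := I / G with hc
  have hnn : 0 ≤ ∫ x, (φ x - c) ^ 2 * g x ∂ν := integral_nonneg fun x => mul_nonneg (sq_nonneg _) (hg0 x)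
  have hA := integral_sub hφ2g (hφg.const_mul (2 * c))
  have hB := integral_add (hφ2g.sub (hφg.const_mul (2 * c))) (hg.const_mul (c ^ 2))
  simp only [Pi.sub_apply] at hA hB
  have hfun : (fun x => (φ x - c) ^ 2 * g x) = fun x => (φ x ^ 2 * g x - 2 * c * (φ x * g x)) + c ^ 2 * g x := by
    funext x; ring
  have hexp : ∫ x, (φ x - c) ^ 2 * g x ∂ν = (∫ x, φ x ^ 2 * g x ∂ν) - 2 * c * I + c ^ 2 * G := by
    rw [hfun, hB, hA, integral_const_mul, integral_const_mul]
  rw [hexp] at hnn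
  have hcI : 2 * c * I = 2 * I ^ 2 / G := by rw [hc]; field_simp
  have hcG : c ^ 2 * G = I ^ 2 / G := by rw [hc]; field_simp
  rw [hcI, hcG] at hnn
  have e2 : 2 * I ^ 2 / G = 2 * (I ^ 2 / G) := by ring
  rw [e2] at hnn
  have h2 : I ^ 2 / G ≤ ∫ x, φ x ^ 2 * g x ∂ν := by linarith
  rwa [div_le_iff₀ hG] at h2

/-- The read-out exponent `ρ(v) = r·e^{−v₀²}` is POSITIVE for `0 < r`. [folklore] -/
theorem readOutExp_pos (hr0 : 0 < r) (v : E1) : 0 < r * Real.exp (-(crd v ^ 2)) := mul_pos hr0 (Real.exp_pos _)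

/-- [folklore] The second difference of W33's increment densities at contour radii `r∕4`, `r∕2` is a SQUARE:
`incr(r∕2) − 2·incr(r∕4) = (e^{ρ∕4} − 1)²·e^{−‖v‖²}` (`ρ = r·e^{−v₀²}`). -/
theorem incr_second_diff (v : E1) :
    incr (1 / 2 * r) v - 2 * incr (1 / 4 * r) v =
      (Real.exp (1 / 4 * r * Real.exp (-(crd v ^ 2))) - 1) ^ 2 * Real.exp (-‖v‖ ^ 2) := by
  unfold incr
  have h : Real.exp (1 / 2 * r * Real.exp (-(crd v ^ 2))) = Real.exp (1 / 4 * r * Real.exp (-(crd v ^ 2))) ^ 2 := by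
    rw [← Real.exp_nat_mul]; congr 1; push_cast; ring
  rw [h]; ring

/-- [folklore] … and `incr(r∕4) = (e^{ρ∕4} − 1)·e^{−‖v‖²}`. -/
theorem incr_quarter (v : E1) :
    incr (1 / 4 * r) v = (Real.exp (1 / 4 * r * Real.exp (-(crd v ^ 2))) - 1) * Real.exp (-‖v‖ ^ 2) := rfl

/-- **THE SECOND DIFFERENCE IS POSITIVE** [folklore]: `0 < J = ∫ (incr(r∕2) − 2·incr(r∕4)) = ∫ (e^{ρ∕4} − 1)²·e^{−‖v‖²}` for `0 < r`
(a continuous, everywhere positive integrand). -/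
theorem second_diff_pos (hr0 : 0 < r) : 0 < ∫ v : E1, (incr (1 / 2 * r) v - 2 * incr (1 / 4 * r) v) := by
  simp_rw [incr_second_diff]
  have hpos : ∀ v : E1, 0 < (Real.exp (1 / 4 * r * Real.exp (-(crd v ^ 2))) - 1) ^ 2 * Real.exp (-‖v‖ ^ 2) := fun v => by
    exact mul_pos (pow_pos (sub_pos.2 (Real.one_lt_exp_iff.2 (mul_pos (mul_pos (by norm_num) hr0) (Real.exp_pos _)))) 2)
      (Real.exp_pos _)
  have hint : Integrable fun v : E1 => (Real.exp (1 / 4 * r * Real.exp (-(crd v ^ 2))) - 1) ^ 2 * Real.exp (-‖v‖ ^ 2) := by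
    have h := (integrable_incr (1 / 2 * r) (by linarith)).sub ((integrable_incr (1 / 4 * r) (by linarith)).const_mul 2)
    exact h.congr (Filter.Eventually.of_forall fun v => incr_second_diff r v)
  have hsupp : Function.support (fun v : E1 => (Real.exp (1 / 4 * r * Real.exp (-(crd v ^ 2))) - 1) ^ 2 * Real.exp (-‖v‖ ^ 2)) =
      Set.univ := Set.eq_univ_of_forall fun v => (hpos v).ne'
  rw [integral_pos_iff_support_of_nonneg_ae (Filter.Eventually.of_forall fun v => (hpos v).le) hint, hsupp]
  exact isOpen_univ.measure_pos volume Set.univ_nonempty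

include hr in
/-- **CAUCHY–SCHWARZ FOR THE FIRST INCREMENT** [folklore]: `(∫ incr(r∕4))² ≤ (∫ (incr(r∕2) − 2·incr(r∕4)))·√π` — `φ = e^{ρ∕4} − 1`
against the Gaussian weight (`sq_integral_le`, W33's `gaussian_E1`). -/
theorem sq_incr_quarter_le :
    (∫ v : E1, incr (1 / 4 * r) v) ^ 2 ≤ (∫ v : E1, (incr (1 / 2 * r) v - 2 * incr (1 / 4 * r) v)) * Real.sqrt Real.pi := by
  rw [← gaussian_E1]
  simp_rw [incr_second_diff, incr_quarter]
  have hφg : Integrable (fun v : E1 => (Real.exp (1 / 4 * r * Real.exp (-(crd v ^ 2))) - 1) * Real.exp (-‖v‖ ^ 2)) :=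
    integrable_incr (1 / 4 * r) (by linarith)
  have hφ2g : Integrable (fun v : E1 => (Real.exp (1 / 4 * r * Real.exp (-(crd v ^ 2))) - 1) ^ 2 * Real.exp (-‖v‖ ^ 2)) := by
    have h := (integrable_incr (1 / 2 * r) (by linarith)).sub ((integrable_incr (1 / 4 * r) (by linarith)).const_mul 2)
    exact h.congr (Filter.Eventually.of_forall fun v => incr_second_diff r v)
  exact sq_integral_le (fun v => (Real.exp_pos _).le) hφg hφ2g integrable_gauss_E1 (by rw [gaussian_E1]; positivity)

/-- **W35's ACTIVITY AT SOURCE ZERO IN CLOSED FORM** [decided toy]: `actM 0 (X₀) = cM·√π` (W35 `termBi_coreFam_M` at `s = 0`, W33's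
`gaussian_E1`). [folklore] -/
theorem actM_zero_X₀ (k : ℕ) : actM N r hr k 0 (X₀ N) = ((cM r * Real.sqrt Real.pi : ℝ) : ℂ) := by
  unfold actM
  rw [termsW_X₀, Finset.sum_singleton, termBi_coreFam_M]
  have h : ∀ v : E1, cexp (0 * ((r : ℂ) * (Real.exp (-(crd v ^ 2)) : ℂ))) * cexp (-(((‖v‖ ^ 2 : ℝ) : ℂ))) =
      ((Real.exp (-‖v‖ ^ 2) : ℝ) : ℂ) := fun v => by
    rw [zero_mul, Complex.exp_zero, one_mul, ← Complex.ofReal_neg, ← Complex.ofReal_exp]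
  simp_rw [h]
  rw [integral_complex_ofReal, gaussian_E1]
  push_cast
  ring

/-- **W35's ACTIVITY AT A REAL SOURCE IN CLOSED FORM** [decided toy]: `actM t (X₀) = cM·(√π + ∫ incr(t·r))` (W35 `actM_real_sub_zero` +
`actM_zero_X₀`). [folklore] -/
theorem actM_real_X₀ (k : ℕ) (t : ℝ) :
    actM N r hr k (t : ℂ) (X₀ N) = ((cM r * (Real.sqrt Real.pi + ∫ v : E1, incr (t * r) v) : ℝ) : ℂ) := by
  have h := actM_real_sub_zero N r hr k t
  rw [actM_zero_X₀, sub_eq_iff_eq_add] at h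
  rw [h]; push_cast; ring

open Classical in
/-- **THE MIXED DIFFERENCE IS NOT ZERO** [decided toy]: at source step `μ = ¼` and content `¼ • liveTable`,
`E[actM ½](X₀) − E[actM ¼](X₀) − (E[actM ¼](X₀) − E[actM 0](X₀)) ≠ 0`.  Were it zero, W24's `exp_locE_cube` (`e^{E[w](X₀)} = 1 + w(X₀)` for
`‖w(X₀)‖ < 1`, W35 `norm_actM_X₀_lt_one`) would give `(1 + a(½))·(1 + a(0)) = (1 + a(¼))²` for the REAL activities `a(t) = cM·(√π + ∫ incr(t·r))`;
but the difference of the two sides is `c·J + c²·(√π·J − I₁²)` with `c = cM r > 0`, `J = ∫ (incr(r∕2) − 2·incr(r∕4)) > 0` (`second_diff_pos`) and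
`I₁² ≤ J·√π` (`sq_incr_quarter_le`) — positive. [folklore] -/
theorem reborn_live (hr0 : 0 < r) (k : ℕ) :
    locE (tgeometry 4 N).ι (tgeometry 4 N).cubes (actM N r hr k ((1 / 4 : ℂ) + 1 * (1 / 4 : ℂ))) ((tgeometry 4 N).cubes (X₀ N)) -
        locE (tgeometry 4 N).ι (tgeometry 4 N).cubes (actM N r hr k (0 + 1 * (1 / 4 : ℂ))) ((tgeometry 4 N).cubes (X₀ N)) -
        (locE (tgeometry 4 N).ι (tgeometry 4 N).cubes (actM N r hr k ((1 / 4 : ℂ) + 0 * (1 / 4 : ℂ))) ((tgeometry 4 N).cubes (X₀ N)) -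
          locE (tgeometry 4 N).ι (tgeometry 4 N).cubes (actM N r hr k (0 + 0 * (1 / 4 : ℂ))) ((tgeometry 4 N).cubes (X₀ N))) ≠ 0 := by
  -- the four sources are the reals ½, ¼, ¼, 0
  have e2 : (1 / 4 : ℂ) + 1 * (1 / 4 : ℂ) = ((1 / 2 : ℝ) : ℂ) := by push_cast; ring
  have e1 : (0 : ℂ) + 1 * (1 / 4 : ℂ) = ((1 / 4 : ℝ) : ℂ) := by push_cast; ring
  have e1' : (1 / 4 : ℂ) + 0 * (1 / 4 : ℂ) = ((1 / 4 : ℝ) : ℂ) := by push_cast; ring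
  have e0 : (0 : ℂ) + 0 * (1 / 4 : ℂ) = ((0 : ℝ) : ℂ) := by push_cast; ring
  rw [e2, e1, e1', e0]
  intro h
  -- exponentiate: e^{f(½) + f(0)} = e^{f(¼) + f(¼)}
  have hsum : locE (tgeometry 4 N).ι (tgeometry 4 N).cubes (actM N r hr k ((1 / 2 : ℝ) : ℂ)) ((tgeometry 4 N).cubes (X₀ N)) +
        locE (tgeometry 4 N).ι (tgeometry 4 N).cubes (actM N r hr k ((0 : ℝ) : ℂ)) ((tgeometry 4 N).cubes (X₀ N)) =
      locE (tgeometry 4 N).ι (tgeometry 4 N).cubes (actM N r hr k ((1 / 4 : ℝ) : ℂ)) ((tgeometry 4 N).cubes (X₀ N)) +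
        locE (tgeometry 4 N).ι (tgeometry 4 N).cubes (actM N r hr k ((1 / 4 : ℝ) : ℂ)) ((tgeometry 4 N).cubes (X₀ N)) := by
    linear_combination h
  have hn : ∀ t : ℝ, |t| ≤ 2 → ‖actM N r hr k (t : ℂ) (X₀ N)‖ < 1 := fun t ht =>
    norm_actM_X₀_lt_one N r hr k (by rw [Complex.norm_real, Real.norm_eq_abs]; exact ht)
  have hexp := congrArg cexp hsum
  rw [Complex.exp_add, Complex.exp_add] at hexp
  have hx : ∀ t : ℝ, |t| ≤ 2 → cexp (locE (tgeometry 4 N).ι (tgeometry 4 N).cubes (actM N r hr k (t : ℂ)) ((tgeometry 4 N).cubes (X₀ N))) =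
      1 + actM N r hr k (t : ℂ) (X₀ N) := fun t ht => exp_locE_cube N (w := actM N r hr k (t : ℂ)) (hn t ht)
  rw [hx _ (by norm_num), hx _ (by norm_num), hx _ (by norm_num), actM_real_X₀, actM_real_X₀, actM_real_X₀] at hexp
  rw [zero_mul] at hexp
  -- the real identity (1 + c(G + I₂))(1 + c·G) = (1 + c(G + I₁))², with ∫ incr 0 = 0
  have hI0 : ∫ v : E1, incr 0 v = 0 := by
    have : ∀ v : E1, incr 0 v = 0 := fun v => by unfold incr; simp
    simp_rw [this, integral_zero]
  rw [hI0, add_zero] at hexp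
  have hreal : (1 + cM r * (Real.sqrt Real.pi + ∫ v : E1, incr (1 / 2 * r) v)) * (1 + cM r * Real.sqrt Real.pi) =
      (1 + cM r * (Real.sqrt Real.pi + ∫ v : E1, incr (1 / 4 * r) v)) * (1 + cM r * (Real.sqrt Real.pi + ∫ v : E1, incr (1 / 4 * r) v)) := by
    exact_mod_cast hexp
  -- Cauchy–Schwarz + the positive second difference contradict it
  set c := cM r with hcdef
  set G := Real.sqrt Real.pi with hGdef
  set I₁ := ∫ v : E1, incr (1 / 4 * r) v with hI₁
  set I₂ := ∫ v : E1, incr (1 / 2 * r) v with hI₂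
  have hc : 0 < c := cM_pos r
  have hGpos : 0 < G := Real.sqrt_pos.2 Real.pi_pos
  have hJ : 0 < I₂ - 2 * I₁ := by
    have h := second_diff_pos r hr0
    rwa [integral_sub (integrable_incr (1 / 2 * r) (by linarith)) ((integrable_incr (1 / 4 * r) (by linarith)).const_mul 2),
      integral_const_mul] at h
  have hCS : I₁ ^ 2 ≤ (I₂ - 2 * I₁) * G := by
    have h := sq_incr_quarter_le r hr
    rwa [integral_sub (integrable_incr (1 / 2 * r) (by linarith)) ((integrable_incr (1 / 4 * r) (by linarith)).const_mul 2),
      integral_const_mul] at h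
  have hkey : (1 + c * (G + I₂)) * (1 + c * G) - (1 + c * (G + I₁)) * (1 + c * (G + I₁)) =
      c * (I₂ - 2 * I₁) + c ^ 2 * ((I₂ - 2 * I₁) * G - I₁ ^ 2) := by ring
  have hgt : 0 < (1 + c * (G + I₂)) * (1 + c * G) - (1 + c * (G + I₁)) * (1 + c * (G + I₁)) := by
    rw [hkey]
    have h1 : 0 < c * (I₂ - 2 * I₁) := mul_pos hc hJ
    have h2 : 0 ≤ c ^ 2 * ((I₂ - 2 * I₁) * G - I₁ ^ 2) := mul_nonneg (sq_nonneg _) (by linarith)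
    linarith
  rw [hreal, sub_self] at hgt
  exact lt_irrefl _ hgt

open Classical in
/-- **THE BILINEAR END's BOUNDED QUANTITY IS LIVE** [decided toy]: at `μ = ¼` the mixed difference bounded by `rebornEnd_fires_closed`
(`≤ (16∕3)·K₀(64,8)·¼·‖¼ • liveTable‖ = (4∕3)·K₀(64,8)·‖¼ • liveTable‖`) is NOT zero — S56's dressed regeneration face is inhabited by a
datum on which it is not vacuous. [folklore] -/
theorem rebornEnd_live (hr0 : 0 < r) (k : ℕ) :
    locE (tgeometry 4 N).ι (tgeometry 4 N).cubes (actM N r hr k ((1 / 4 : ℂ) + 1 * (1 / 4 : ℂ))) ((tgeometry 4 N).cubes (X₀ N)) -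
        locE (tgeometry 4 N).ι (tgeometry 4 N).cubes (actM N r hr k (0 + 1 * (1 / 4 : ℂ))) ((tgeometry 4 N).cubes (X₀ N)) -
        (locE (tgeometry 4 N).ι (tgeometry 4 N).cubes (actM N r hr k ((1 / 4 : ℂ) + 0 * (1 / 4 : ℂ))) ((tgeometry 4 N).cubes (X₀ N)) -
          locE (tgeometry 4 N).ι (tgeometry 4 N).cubes (actM N r hr k (0 + 0 * (1 / 4 : ℂ))) ((tgeometry 4 N).cubes (X₀ N))) ≠ 0 ∧
    ‖locE (tgeometry 4 N).ι (tgeometry 4 N).cubes (actM N r hr k ((1 / 4 : ℂ) + 1 * (1 / 4 : ℂ))) ((tgeometry 4 N).cubes (X₀ N)) -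
        locE (tgeometry 4 N).ι (tgeometry 4 N).cubes (actM N r hr k (0 + 1 * (1 / 4 : ℂ))) ((tgeometry 4 N).cubes (X₀ N)) -
        (locE (tgeometry 4 N).ι (tgeometry 4 N).cubes (actM N r hr k ((1 / 4 : ℂ) + 0 * (1 / 4 : ℂ))) ((tgeometry 4 N).cubes (X₀ N)) -
          locE (tgeometry 4 N).ι (tgeometry 4 N).cubes (actM N r hr k (0 + 0 * (1 / 4 : ℂ))) ((tgeometry 4 N).cubes (X₀ N)))‖ ≤
      4 / 3 * K₀ 64 8 * ‖((1 / 4 : ℂ)) • (liveTable : B13HistM toyFrame)‖ := by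
  refine ⟨reborn_live N r hr hr0 k, (rebornEnd_fires_closed N r hr hr0 k (μ := (1 / 4 : ℂ))
    (mem_ball_zero_iff.2 (by norm_num))).trans (le_of_eq ?_)⟩
  have h : ‖(1 / 4 : ℂ)‖ = 1 / 4 := by norm_num
  rw [h]; ring

end Summit.QuantumFields.BalabanUV.T4Continuum.NE1p.DressedRebornMuPartBipencilWitness

end
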